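import Mathlib
import Summits.AtomisticToContinuum.Crystallization.Theorems.GappedShellCensusFiveFoldRationingRStubFfrC5CoreFourth

/-!
# Crux `GappedShellCensus.FiveFoldRationingR` (stmt-AtomisticToContinuum-18071), line `Sketch` —
# stub `stub_ffrC5Core` (the finite core of the capped census),
# file 5/6: the quadrilateral faces, the second ring, and the labelled prism
# (registered sub-goal `stub_ffrC5CoreLabels`)

Setting (abstract fan data on the twelve labels `Fin 12`): a family `tri` of `3`-element label sets,
two per side, and a symmetric irreflexive Boolean bond relation with degrees in `{4, 5}`; every bond
is a side of exactly two members of `tri`, every bonded `3`-clique is in `tri`, every member of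
`tri` has a vertex bonded to the other two, every `5`-valent label has only bonded fan triangles and
every `4`-valent label at most two.

This file: around the pole `w` with link pentagon `u` and fourth partners `x`: no fan triangle
contains three consecutive `u`'s; the second fan triangle on the pentagon side `{u i, u (i + 1)}` is
`{u i, u (i + 1), x i}` or `{u i, u (i + 1), x (i + 1)}` (a half of the quadrilateral face `u i, u
(i + 1), x (i + 1), x i`), and the other half shows `x i ~ x (i + 1)`: the second ring closes up.
Bonds `x i ~ x j` are bonds between partners of the other pole `w'`, hence pentagon steps there, and
`x i ~ x (i ± 2)` would be an odd closed walk of three `±1` steps.  Assembling: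
`stub_ffrC5CoreLabels`, twelve distinct labels `w, u 0…4, x 0…4, w'` with the complete bond table of
the bicapped pentagonal prism.
-/

noncomputable section

namespace Summit.AtomisticToContinuum.Crystallization.Theorems

open Finset

section Structure

variable {bond : Fin 12 → Fin 12 → Bool} {tri : Finset (Finset (Fin 12))}
  (bond_symm : ∀ v w, bond v w = bond w v) (bond_irrefl : ∀ v, bond v v = false)
  (bond_deg : ∀ v, 4 ≤ (Finset.univ.filter fun w => bond v w = true).card ∧
    (Finset.univ.filter fun w => bond v w = true).card ≤ 5)
  (tri_card : ∀ S ∈ tri, S.card = 3)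
  (two_per_side : ∀ S ∈ tri, ∀ s ⊆ S, s.card = 2 → (tri.filter fun S' => s ⊆ S').card = 2)
  (bond_side : ∀ v w, bond v w = true →
    (tri.filter fun S' => ({v, w} : Finset (Fin 12)) ⊆ S').card = 2)
  (bond_tri : ∀ a b c, a ≠ b → b ≠ c → a ≠ c → bond a b = true → bond b c = true →
    bond a c = true → ({a, b, c} : Finset (Fin 12)) ∈ tri)
  (two_bond_sides : ∀ S ∈ tri, ∃ a ∈ S, ∀ b ∈ S, b ≠ a → bond a b = true)
  (five_T : ∀ v, (Finset.univ.filter fun w => bond v w = true).card = 5 →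
    ∀ S ∈ tri, v ∈ S → ∀ a ∈ S, ∀ b ∈ S, a ≠ b → bond a b = true)
  (four_T : ∀ v, (Finset.univ.filter fun w => bond v w = true).card = 4 →
    ((tri.filter fun S => v ∈ S).filter
      fun S => ∀ a ∈ S, ∀ b ∈ S, a ≠ b → bond a b = true).card ≤ 2)
variable {w : Fin 12} {u x : Fin 5 → Fin 12}
  (hw : (Finset.univ.filter fun z => bond w z = true).card = 5)
  (hu : Function.Injective u) (hwu : ∀ i, bond w (u i) = true)
  (hcov : ∀ a, bond w a = true → ∃ i, u i = a)
  (hT : ∀ i, ({w, u i, u (i + 1)} : Finset (Fin 12)) ∈ tri)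
  (hcl : ∀ S ∈ tri, w ∈ S → ∃ i, S = ({w, u i, u (i + 1)} : Finset (Fin 12)))
  (hx : ∀ i, bond (u i) (x i) = true ∧ x i ≠ w ∧ x i ≠ u (i - 1) ∧ x i ≠ u (i + 1) ∧
    ∀ z, bond (u i) z = true → z = w ∨ z = u (i - 1) ∨ z = u (i + 1) ∨ z = x i)
  (hD : ∀ v a, (Finset.univ.filter fun z => bond v z = true).card = 5 → bond v a = true →
    (Finset.univ.filter fun z => bond a z = true).card = 4)

include bond_symm bond_irrefl tri_card two_per_side bond_tri two_bond_sides five_T hw hu hwu hcl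
  hx in
/-- No fan triangle contains three consecutive partners of the pole. [folklore] -/
theorem ffrCC_noR (hxinj : Function.Injective x) (i : Fin 5) (S : Finset (Fin 12))
    (hS : S ∈ tri) : ¬ (u (i - 1) ∈ S ∧ u i ∈ S ∧ u (i + 1) ∈ S) := by
  rintro ⟨hm, h0, hp⟩
  have hmp : u (i - 1) ≠ u (i + 1) := fun h => by have := hu h; omega
  have hm0 : u (i - 1) ≠ u i := fun h => by have := hu h; omega
  have h0p : u i ≠ u (i + 1) := fun h => by have := hu h; omega
  have hnb : ∀ a b : Fin 5, a = i - 1 → b = i + 1 → bond (u a) (u b) ≠ true := by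
    intro a b ea eb h
    have := ffrCC_chord bond_irrefl bond_tri hu hwu hcl h
    omega
  have hsub : ({u (i - 1), u (i + 1)} : Finset (Fin 12)) ⊆ S := by
    simp [Finset.insert_subset_iff, hm, hp]
  have h2 := two_per_side S hS _ hsub (Finset.card_pair hmp)
  have memP : ∀ R, R ∈ tri.filter (fun S' => ({u (i - 1), u (i + 1)} : Finset (Fin 12)) ⊆ S') ↔
      R ∈ tri ∧ u (i - 1) ∈ R ∧ u (i + 1) ∈ R := by
    intro R
    simp only [Finset.mem_filter, Finset.insert_subset_iff, Finset.singleton_subset_iff]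
  obtain ⟨R, hR, hRS⟩ := ffrCC_other_of_card_two h2 ((memP S).2 ⟨hS, hm, hp⟩)
  obtain ⟨hRt, hmR, hpR⟩ := (memP R).1 hR
  obtain ⟨z, hzm, hzp, hReq⟩ := eq_three_of_two_mem (tri_card R hRt) hmR hpR hmp
  have hz0 : z ≠ u i := by
    intro e
    apply hRS
    rw [hReq, e, eq_three_of_mem_of_card (tri_card S hS) hm hp h0 hmp hm0 h0p.symm]
  obtain ⟨a, haR, ha⟩ := two_bond_sides R hRt
  rw [hReq] at haR ha
  simp only [Finset.mem_insert, Finset.mem_singleton] at haR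
  rcases haR with e | e | e <;> rw [e] at ha
  · exact hnb _ _ rfl rfl (ha (u (i + 1)) (by simp) hmp.symm)
  · have := ha (u (i - 1)) (by simp) hmp
    rw [bond_symm] at this
    exact hnb _ _ rfl rfl this
  · have hbm : bond (u (i - 1)) z = true := by rw [bond_symm]; exact ha _ (by simp) hzm.symm
    have hbp : bond (u (i + 1)) z = true := by rw [bond_symm]; exact ha _ (by simp) hzp.symm
    rcases (hx (i - 1)).2.2.2.2 z hbm with e | e | e | e
    · apply hnb _ _ rfl rfl
      refine five_T w hw R hRt ?_ (u (i - 1)) hmR (u (i + 1)) hpR hmp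
      rw [hReq, e]; simp
    · rcases (hx (i + 1)).2.2.2.2 z hbp with e' | e' | e' | e' <;> rw [e] at e'
      · exact (ffrCC_ne_of_bond bond_irrefl (hwu _)) e'
      · have := hu e'; omega
      · have := hu e'; omega
      · exact ffrCC_x_ne_u bond_irrefl bond_tri hu hwu hcl hx (i + 1) (i - 1 - 1) e'.symm
    · apply hz0
      rw [e]
      congr 1
      omega
    · rcases (hx (i + 1)).2.2.2.2 z hbp with e' | e' | e' | e' <;> rw [e] at e'
      · exact (hx (i - 1)).2.1 e'
      · exact ffrCC_x_ne_u bond_irrefl bond_tri hu hwu hcl hx (i - 1) (i + 1 - 1) e'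
      · exact ffrCC_x_ne_u bond_irrefl bond_tri hu hwu hcl hx (i - 1) (i + 1 + 1) e'
      · have := hxinj e'; omega

include bond_symm bond_irrefl tri_card two_per_side bond_side bond_tri two_bond_sides five_T four_T
  hw hu hwu hT hcl hx hD in
/-- **The quadrilateral faces.**  The second fan triangle on the pentagon side `{u i, u (i + 1)}`
is `{u i, u (i + 1), x i}` or `{u i, u (i + 1), x (i + 1)}`. [folklore] -/
theorem ffrCC_quad (hxinj : Function.Injective x) (i : Fin 5) :
    ({u i, u (i + 1), x i} : Finset (Fin 12)) ∈ tri ∨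
      ({u i, u (i + 1), x (i + 1)} : Finset (Fin 12)) ∈ tri := by
  have h0p : u i ≠ u (i + 1) := fun h => by have := hu h; omega
  have hb := (ffrCC_uu five_T hw hu hT i).1
  have memP : ∀ R, R ∈ tri.filter (fun S' => ({u i, u (i + 1)} : Finset (Fin 12)) ⊆ S') ↔
      R ∈ tri ∧ u i ∈ R ∧ u (i + 1) ∈ R := by
    intro R
    simp only [Finset.mem_filter, Finset.insert_subset_iff, Finset.singleton_subset_iff]
  obtain ⟨Q, hQ, hQT⟩ := ffrCC_other_of_card_two (bond_side _ _ hb)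
    ((memP _).2 ⟨hT i, by simp, by simp⟩)
  obtain ⟨hQt, h0Q, hpQ⟩ := (memP Q).1 hQ
  obtain ⟨y, hy0, hyp, hQeq⟩ := eq_three_of_two_mem (tri_card Q hQt) h0Q hpQ h0p
  have hyw : y ≠ w := by
    intro e
    apply hQT
    rw [hQeq, e]
    exact (tri_rotl w (u i) (u (i + 1))).symm
  have hQnb : ¬ ∀ a ∈ Q, ∀ b ∈ Q, a ≠ b → bond a b = true := by
    intro hb'
    rcases ffrCC_bonded_at_u bond_irrefl five_T four_T hw hu hwu hT hD i Q hQt h0Q hb' with e | e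
    · have : u (i + 1) ∈ ({w, u (i - 1), u i} : Finset (Fin 12)) := by rw [← e]; exact hpQ
      simp only [Finset.mem_insert, Finset.mem_singleton] at this
      rcases this with h | h | h
      · exact (ffrCC_ne_of_bond bond_irrefl (hwu _)) h
      · have := hu h; omega
      · have := hu h; omega
    · exact hQT e
  obtain ⟨a, haQ, ha⟩ := two_bond_sides Q hQt
  rw [hQeq] at haQ ha
  simp only [Finset.mem_insert, Finset.mem_singleton] at haQ
  rcases haQ with e | e | e <;> rw [e] at ha
  · have hy : bond (u i) y = true := ha y (by simp) hy0
    rcases (hx i).2.2.2.2 y hy with h | h | h | h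
    · exact absurd h hyw
    · exfalso
      refine ffrCC_noR bond_symm bond_irrefl tri_card two_per_side bond_tri two_bond_sides five_T
        hw hu hwu hcl hx hxinj i Q hQt ⟨?_, h0Q, hpQ⟩
      rw [hQeq, h]; simp
    · exact absurd h hyp
    · left; rw [← h, ← hQeq]; exact hQt
  · have hy : bond (u (i + 1)) y = true := ha y (by simp) hyp
    rcases (hx (i + 1)).2.2.2.2 y hy with h | h | h | h
    · exact absurd h hyw
    · exfalso; apply hy0; rw [h]; congr 1; omega
    · exfalso
      have e1 : i + 1 - 1 = i := by omega
      refine ffrCC_noR bond_symm bond_irrefl tri_card two_per_side bond_tri two_bond_sides five_T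
        hw hu hwu hcl hx hxinj (i + 1) Q hQt ⟨?_, hpQ, ?_⟩
      · rw [e1]; exact h0Q
      · rw [hQeq, h]; simp
    · right; rw [← h, ← hQeq]; exact hQt
  · exfalso
    apply hQnb
    have hy0' : bond y (u i) = true := ha _ (by simp) hy0.symm
    have hyp' : bond y (u (i + 1)) = true := ha _ (by simp) hyp.symm
    rw [hQeq]
    exact ffrCC_bonded3 bond_symm hb (by rw [bond_symm]; exact hy0')
      (by rw [bond_symm]; exact hyp')

include bond_symm bond_irrefl tri_card two_per_side bond_side bond_tri two_bond_sides five_T four_T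
  hw hu hwu hcov hT hcl hx hD in
/-- **The second ring closes up.** Consecutive fourth partners are bonded. [folklore] -/
theorem ffrCC_xx_step (hxinj : Function.Injective x) (i : Fin 5) :
    bond (x i) (x (i + 1)) = true := by
  have hux := ffrCC_ux bond_irrefl bond_tri hu hwu hcl hx hxinj
  have hwx := ffrCC_wx bond_irrefl bond_tri hu hwu hcov hcl hx
  rcases ffrCC_quad bond_symm bond_irrefl tri_card two_per_side bond_side bond_tri two_bond_sides
    five_T four_T hw hu hwu hT hcl hx hD hxinj i with hA | hB
  · have hne : u (i + 1) ≠ x i := (ffrCC_x_ne_u bond_irrefl bond_tri hu hwu hcl hx i (i + 1)).symm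
    have hsub : ({u (i + 1), x i} : Finset (Fin 12)) ⊆ {u i, u (i + 1), x i} := by simp
    have h2 := two_per_side _ hA _ hsub (Finset.card_pair hne)
    have memP : ∀ R, R ∈ tri.filter (fun S' => ({u (i + 1), x i} : Finset (Fin 12)) ⊆ S') ↔
        R ∈ tri ∧ u (i + 1) ∈ R ∧ x i ∈ R := by
      intro R
      simp only [Finset.mem_filter, Finset.insert_subset_iff, Finset.singleton_subset_iff]
    obtain ⟨R, hR, hRA⟩ := ffrCC_other_of_card_two h2 ((memP _).2 ⟨hA, by simp, by simp⟩)
    obtain ⟨hRt, hpR, hxR⟩ := (memP R).1 hR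
    obtain ⟨z, hzp, hzx, hReq⟩ := eq_three_of_two_mem (tri_card R hRt) hpR hxR hne
    have hz0 : z ≠ u i := by
      intro e; apply hRA; rw [hReq, e]; exact (tri_rotl (u i) (u (i + 1)) (x i)).symm
    have hnpx : bond (u (i + 1)) (x i) ≠ true := by
      intro h; have := (hux i (i + 1)).1 h; omega
    obtain ⟨a, haR, ha⟩ := two_bond_sides R hRt
    rw [hReq] at haR ha
    simp only [Finset.mem_insert, Finset.mem_singleton] at haR
    rcases haR with e | e | e <;> rw [e] at ha
    · exact absurd (ha (x i) (by simp) hne.symm) hnpx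
    · rw [bond_symm] at hnpx
      exact absurd (ha (u (i + 1)) (by simp) hne) hnpx
    · have hzp' : bond (u (i + 1)) z = true := by rw [bond_symm]; exact ha _ (by simp) hzp.symm
      have hzx' : bond z (x i) = true := ha _ (by simp) hzx.symm
      rcases (hx (i + 1)).2.2.2.2 z hzp' with h | h | h | h
      · rw [h, hwx] at hzx'; exact absurd hzx' Bool.false_ne_true
      · exfalso; apply hz0; rw [h]; congr 1; omega
      · rw [h] at hzx'; have := (hux i (i + 1 + 1)).1 hzx'; omega
      · rw [h, bond_symm] at hzx'; exact hzx'
  · have hne : u i ≠ x (i + 1) := (ffrCC_x_ne_u bond_irrefl bond_tri hu hwu hcl hx (i + 1) i).symm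
    have hsub : ({u i, x (i + 1)} : Finset (Fin 12)) ⊆ {u i, u (i + 1), x (i + 1)} := by simp
    have h2 := two_per_side _ hB _ hsub (Finset.card_pair hne)
    have memP : ∀ R, R ∈ tri.filter (fun S' => ({u i, x (i + 1)} : Finset (Fin 12)) ⊆ S') ↔
        R ∈ tri ∧ u i ∈ R ∧ x (i + 1) ∈ R := by
      intro R
      simp only [Finset.mem_filter, Finset.insert_subset_iff, Finset.singleton_subset_iff]
    obtain ⟨R, hR, hRB⟩ := ffrCC_other_of_card_two h2 ((memP _).2 ⟨hB, by simp, by simp⟩)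
    obtain ⟨hRt, h0R, hxR⟩ := (memP R).1 hR
    obtain ⟨z, hz0, hzx, hReq⟩ := eq_three_of_two_mem (tri_card R hRt) h0R hxR hne
    have hzp : z ≠ u (i + 1) := by
      intro e; apply hRB; rw [hReq, e]; exact tri_swap23 _ _ _
    have hn0x : bond (u i) (x (i + 1)) ≠ true := by
      intro h; have := (hux (i + 1) i).1 h; omega
    obtain ⟨a, haR, ha⟩ := two_bond_sides R hRt
    rw [hReq] at haR ha
    simp only [Finset.mem_insert, Finset.mem_singleton] at haR
    rcases haR with e | e | e <;> rw [e] at ha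
    · exact absurd (ha (x (i + 1)) (by simp) hne.symm) hn0x
    · rw [bond_symm] at hn0x
      exact absurd (ha (u i) (by simp) hne) hn0x
    · have hz0' : bond (u i) z = true := by rw [bond_symm]; exact ha _ (by simp) hz0.symm
      have hzx' : bond z (x (i + 1)) = true := ha _ (by simp) hzx.symm
      rcases (hx i).2.2.2.2 z hz0' with h | h | h | h
      · rw [h, hwx] at hzx'; exact absurd hzx' Bool.false_ne_true
      · rw [h] at hzx'; have := (hux (i + 1) (i - 1)).1 hzx'; omega
      · exact absurd h hzp
      · rw [h] at hzx'; exact hzx'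

include bond_symm bond_irrefl tri_card two_per_side bond_side bond_tri two_bond_sides five_T four_T
  hw hu hwu hcov hT hcl hx hD in
/-- **Bonds in the second ring** are exactly the ring sides: they are chords-free bonds among the
partners of the other pole `w'`, and a bond `x i ~ x (i ± 2)` together with the ring sides would
be an odd closed walk of `±1` steps of length three in the link pentagon of `w'`. [folklore] -/
theorem ffrCC_xx (hxinj : Function.Injective x) {w' : Fin 12} {u' : Fin 5 → Fin 12}
    (hu' : Function.Injective u') (hwu' : ∀ j, bond w' (u' j) = true)
    (hcl' : ∀ S ∈ tri, w' ∈ S → ∃ j, S = ({w', u' j, u' (j + 1)} : Finset (Fin 12)))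
    (hpos : ∀ i, ∃ j, u' j = x i) (i j : Fin 5) :
    bond (x i) (x j) = true ↔ j = i + 1 ∨ j = i - 1 := by
  have step := ffrCC_xx_step bond_symm bond_irrefl tri_card two_per_side bond_side bond_tri
    two_bond_sides five_T four_T hw hu hwu hcov hT hcl hx hD hxinj
  choose π hπ using hpos
  have tr : ∀ a b, bond (x a) (x b) = true → π b = π a + 1 ∨ π b = π a - 1 := by
    intro a b h
    rw [← hπ a, ← hπ b] at h
    exact ffrCC_chord bond_irrefl bond_tri hu' hwu' hcl' h
  have s1 : ∀ a, π (a + 1) = π a + 1 ∨ π (a + 1) = π a - 1 := fun a => tr a (a + 1) (step a)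
  constructor
  · intro h
    have hij := tr i j h
    rcases ffrCC_fin5_cover i j with e | e | e | e | e
    · rw [e, bond_irrefl] at h
      exact absurd h Bool.false_ne_true
    · exact Or.inl e
    · exfalso
      have a1 := s1 i
      have a2 := s1 (i + 1)
      have e2 : i + 1 + 1 = i + 2 := by omega
      rw [e2] at a2
      rw [e] at hij
      omega
    · exfalso
      have a1 := s1 (i - 1)
      have a2 := s1 (i - 2)
      have e1 : i - 1 + 1 = i := by omega
      have e2 : i - 2 + 1 = i - 1 := by omega
      rw [e1] at a1
      rw [e2] at a2
      rw [e] at hij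
      omega
    · exact Or.inr e
  · rintro (e | e)
    · rw [e]; exact step i
    · rw [e, bond_symm]
      have := step (i - 1)
      have e1 : i - 1 + 1 = i := by omega
      rwa [e1] at this

end Structure

/-- **Registered sub-goal `stub_ffrC5CoreLabels` (the labelled bicapped pentagonal prism).**
Poles `w, w'`, the link pentagon `u` of `w`, the second ring `x` of fourth partners: twelve
distinct labels with the complete bond table. [folklore] -/
theorem stub_ffrC5CoreLabels (bond : Fin 12 → Fin 12 → Bool) (tri : Finset (Finset (Fin 12)))
    (bond_symm : ∀ v w, bond v w = bond w v) (bond_irrefl : ∀ v, bond v v = false)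
    (bond_deg : ∀ v, 4 ≤ (Finset.univ.filter fun w => bond v w = true).card ∧
      (Finset.univ.filter fun w => bond v w = true).card ≤ 5)
    (h4ex : ∃ v, (Finset.univ.filter fun w => bond v w = true).card = 4)
    (h5ex : ∃ v, (Finset.univ.filter fun w => bond v w = true).card = 5)
    (tri_card : ∀ S ∈ tri, S.card = 3)
    (two_per_side : ∀ S ∈ tri, ∀ s ⊆ S, s.card = 2 → (tri.filter fun S' => s ⊆ S').card = 2)
    (bond_side : ∀ v w, bond v w = true →
      (tri.filter fun S' => ({v, w} : Finset (Fin 12)) ⊆ S').card = 2)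
    (bond_tri : ∀ a b c, a ≠ b → b ≠ c → a ≠ c → bond a b = true → bond b c = true →
      bond a c = true → ({a, b, c} : Finset (Fin 12)) ∈ tri)
    (two_bond_sides : ∀ S ∈ tri, ∃ a ∈ S, ∀ b ∈ S, b ≠ a → bond a b = true)
    (five_T : ∀ v, (Finset.univ.filter fun w => bond v w = true).card = 5 →
      ∀ S ∈ tri, v ∈ S → ∀ a ∈ S, ∀ b ∈ S, a ≠ b → bond a b = true)
    (four_T : ∀ v, (Finset.univ.filter fun w => bond v w = true).card = 4 →
      ((tri.filter fun S => v ∈ S).filter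
        fun S => ∀ a ∈ S, ∀ b ∈ S, a ≠ b → bond a b = true).card ≤ 2) :
    ∃ (w w' : Fin 12) (u x : Fin 5 → Fin 12),
      Function.Injective ![w, u 0, u 1, u 2, u 3, u 4, x 0, x 1, x 2, x 3, x 4, w'] ∧
      bond w w' = false ∧ (∀ i, bond w (u i) = true) ∧ (∀ i, bond w (x i) = false) ∧
      (∀ i, bond w' (u i) = false) ∧ (∀ i, bond w' (x i) = true) ∧
      (∀ i j, bond (u i) (u j) = true ↔ j = i + 1 ∨ j = i - 1) ∧
      (∀ i j, bond (u j) (x i) = true ↔ j = i) ∧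
      (∀ i j, bond (x i) (x j) = true ↔ j = i + 1 ∨ j = i - 1) := by
  have hD := ffrCC_no55 bond_symm bond_irrefl bond_deg tri_card bond_side bond_tri five_T four_T h4ex
  obtain ⟨w, w', hww, hw, hw', hcovW⟩ :=
    ffrCC_poles bond_symm bond_irrefl bond_deg tri_card bond_side five_T four_T hD h5ex
  obtain ⟨u, hu, hwu, hcov, hT, hcl⟩ := ffrCC_pentagon bond_irrefl tri_card bond_side five_T w hw
  obtain ⟨u', hu', hwu', hcov', hT', hcl'⟩ :=
    ffrCC_pentagon bond_irrefl tri_card bond_side five_T w' hw'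
  obtain ⟨x, hx⟩ := ffrCC_fourth bond_symm bond_irrefl five_T hw hu hwu hT hD
  obtain ⟨x', hx'⟩ := ffrCC_fourth bond_symm bond_irrefl five_T hw' hu' hwu' hT' hD
  have hw'x := ffrCC_w'x bond_symm bond_irrefl tri_card bond_side bond_tri five_T four_T hw hu hwu
    hcov hcl hx hD hww hw' hcovW
  have hxinj := ffrCC_x_inj bond_symm bond_irrefl tri_card bond_side five_T four_T hw hu hwu hx hD
    hww hw' hwu' hcov' hx' hw'x
  have hwx := ffrCC_wx bond_irrefl bond_tri hu hwu hcov hcl hx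
  have hww' : bond w w' = false := by
    rcases Bool.eq_false_or_eq_true (bond w w') with h | h
    · have := hD w w' hw h; omega
    · exact h
  have hw'u : ∀ i, bond w' (u i) = false := by
    intro i
    rcases Bool.eq_false_or_eq_true (bond w' (u i)) with h | h
    · exact absurd (ffrCC_one5 bond_irrefl tri_card bond_side five_T four_T hD (u i) w w' hw hw'
        (hwu i) h) hww
    · exact h
  have huu := ffrCC_uu_iff bond_irrefl bond_tri five_T hw hu hwu hT hcl
  have hux := ffrCC_ux bond_irrefl bond_tri hu hwu hcl hx hxinj
  have hpos : ∀ i, ∃ j, u' j = x i := fun i => hcov' _ (hw'x i)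
  have hxx := ffrCC_xx bond_symm bond_irrefl tri_card two_per_side bond_side bond_tri two_bond_sides
    five_T four_T hw hu hwu hcov hT hcl hx hD hxinj hu' hwu' hcl' hpos
  refine ⟨w, w', u, x, ?_, hww', hwu, hwx, hw'u, hw'x, huu, hux, hxx⟩
  -- the twelve labels are distinct
  have huw : ∀ i, u i ≠ w := fun i => ffrCC_ne_of_bond bond_irrefl (hwu i)
  have hxw : ∀ i, x i ≠ w := fun i => (hx i).2.1
  have hxu : ∀ i j, x i ≠ u j := ffrCC_x_ne_u bond_irrefl bond_tri hu hwu hcl hx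
  have huw' : ∀ i, u i ≠ w' := by
    intro i e
    have := hwu i
    rw [e, hww'] at this
    exact Bool.false_ne_true this
  have hxw' : ∀ i, x i ≠ w' := fun i => ffrCC_ne_of_bond bond_irrefl (hw'x i)
  have hwu_ne : ∀ i, w ≠ u i := fun i => (huw i).symm
  have hwx_ne : ∀ i, w ≠ x i := fun i => (hxw i).symm
  have hux_ne : ∀ i j, u j ≠ x i := fun i j => (hxu i j).symm
  have hw'u_ne : ∀ i, w' ≠ u i := fun i => (huw' i).symm
  have hw'x_ne : ∀ i, w' ≠ x i := fun i => (hxw' i).symm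
  have hw'w : w' ≠ w := hww.symm
  intro k l hkl
  fin_cases k <;> fin_cases l <;>
    simp [hu.eq_iff, hxinj.eq_iff, huw, hxw, hxu, huw', hxw', hwu_ne, hwx_ne, hux_ne, hw'u_ne,
      hw'x_ne, hww, hw'w] at hkl ⊢

end Summit.AtomisticToContinuum.Crystallization.Theorems

end
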